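import Summits.RiemannHypothesis.RiemannHypothesis.Theorems.Splittings.ScrewKreinCoreLaplace
import HarnessLib

/-!
# Screw index transfer via Kreĭn definitizability — analytic core, part 5/5: (B) the Laplace identity, the core
# theorem `core`, and the discharge of `ScrewIndexTransferKrein.IndexTransferKrein` (Theorem B of
# `cards/SPLIT-screw-bridge.md` §10-U⁗″, KB2; parts 1–4 = `ScrewKreinCoreDefs/Translates/Symbol/Laplace`)

rh-split-screw-bridge g5 (pub cell; typer-1 files).  Companion of the landed
`Theorems/Splittings/ScrewIndexTransferKrein.lean` (p505922: the Prop `IndexTransferKrein`, its reduction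
`indexTransferKrein_of_core` to an analytic core, and `etail_iff_foz_of_indexTransferKrein`) and of the named
printed fact `Literature.Analysis.OperatorTheory.Stewart1972_thm_3_1` (p505527; Kreĭn 1959 = Stewart 1972,
Thm 3.1: a continuous Hermitian-symmetric kernel with exactly `k` negative squares is `Q(−i d/dx)`-definitizable
by a polynomial `Q ≠ 0` of degree `≤ k`).

MAIN RESULTS (complete kernel proofs, no new axioms; nothing here asserts anything about RH):

* `core : ∀ Q : Polynomial ℂ, Q ≠ 0 → KreinPos Q → CofiniteCriticalLine` — for `f = −Ψ` (`Ψ = zetaScrew`):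
  if the `Q(−i d/dx)`-twisted form `∬ f(x−y)(Qφ)(x) conj((Qφ)(y)) dx dy` is nonnegative on test functions,
  then all but finitely many nontrivial zeta zeros lie on the critical line.  PROVED here in six pieces:
  (A) positivity ⟹ the translate form `F_φ(s) = ∬ f(x+s−y)(Qφ)(x)conj((Qφ)(y))` is continuous and bounded
  (`|F_φ(s)| ≤ F_φ(0)`: positivity at `τ_sφ − λφ`, `|λ| = 1`, translation invariance, Hermitian symmetry,
  Fubini); (B) `Lap F_φ` is holomorphic on `Re w > 0` and `Lap F_φ = ĉ_φ · Lap f + H_φ` on `Re w > 1` with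
  `H_φ` ENTIRE (`F_φ = f ∗ c_φ`, `c_φ(u) = ∫ (Qφ)(x) conj((Qφ)(x+u)) dx`; Fubini on `(0,∞) × ℝ`, half-line
  shift); (B′) `Lap f(w) = −w^{-2} (ξ'/ξ)(½ + w)` on `Re w > 1` (tree: `ZetaScrewLaplace`); (C) pole
  bookkeeping: `G` holomorphic on `Re w > 0`, `G = c · Lap f + H` on `Re w > 1`, `c, H` entire ⟹ `c(w₀) = 0`
  at every zero `½ + w₀` of `ξ`, `Re w₀ > 0` (order count at the pole of `ξ'/ξ`); (D) symbol:
  `ĉ_φ(w) = Q(iw) · conj Q(conj(iw)) · φ̂(−w) · conj(φ̂(w̄))` (integration by parts); (E) bump choice: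
  `φ̂(−a) conj(φ̂(ā)) ≠ 0` for a narrow bump; (F) count: the off-line zeros then lie among the `≤ 2 deg Q`
  roots, reflected ⟹ `CofiniteCriticalLine`.  `core_of_pieces` is the assembly, `core` the discharge.
* `indexTransferKrein : ScrewIndexTransferKrein.IndexTransferKrein`, i.e.
  `Stewart1972_thm_3_1 → (∃ K, ∀ n, #{negative eigenvalues of screwMatrix n} ≤ K) → CofiniteCriticalLine`.
* `etail_iff_foz (h1 : Stewart1972_thm_3_1) : (∃ M₀, ∀ M ≥ M₀, 0 < screwPivot M) ↔ CofiniteCriticalLine`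
  — T2 «ETAIL ⟺ FOZ» of the splitting search as a kernel theorem MODULO THE ONE NAMED PRINTED FACT
  (forward direction `etail_of_foz` is unconditional in the tree; the new content is FOZ ⟸ ETAIL).

HONEST LABEL.  `CofiniteCriticalLine` (all but finitely many nontrivial zeros on the line) is NOT RH, and
ETAIL (eventual positivity of the screw pivots) is NOT the screw criterion `∀ M, 0 < screwPivot M`; this file
relates the two tails to each other and decides neither.  Nothing here bears on the truth of RH.
-/

noncomputable section

set_option linter.dupNamespace false

namespace Summit.RiemannHypothesis.RiemannHypothesis.Theorems.Splittings.ScrewKreinCore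

open Finset Complex MeasureTheory Set Filter Topology
open Literature.NumberTheory.LFunctions
open Literature.Analysis.OperatorTheory
open Summit.RiemannHypothesis.RiemannHypothesis.Theses.RuelleBand
open Summit.RiemannHypothesis.RiemannHypothesis.Theorems.IntegerScrew

/-! ## Towards (B): the Laplace identity on `Re w > 1` (B3) -/

/-- `fC · e^{−wt}` is integrable on `(0, ∞)` for `Re w > 1/2` (Suzuki). -/
theorem integrableOn_fC_Ioi {w : ℂ} (hw : 1 / 2 < w.re) :
    IntegrableOn (fun t : ℝ => fC t * cexp (-(w * t))) (Ioi 0) := by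
  have ha : (-w).re < -1 / 2 := by simp; linarith
  have hint := (ZetaScrewLaplace.integral_zetaScrew_mul_cexp ha).1
  have e : (fun t : ℝ => fC t * cexp (-(w * t))) =
      fun t => -((zetaScrew t : ℂ) * cexp (-w * t)) := by
    funext t; simp only [fC, ofReal_neg, neg_mul]
  rw [e]; exact hint.neg

/-- … hence on every half-line `(a, ∞)` (continuity on the compact part). -/
theorem integrableOn_fC_Ioi' {w : ℂ} (hw : 1 / 2 < w.re) (a : ℝ) :
    IntegrableOn (fun t : ℝ => fC t * cexp (-(w * t))) (Ioi a) := by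
  have hc : Continuous fun t : ℝ => fC t * cexp (-(w * t)) := continuous_fC.mul (by fun_prop)
  refine ((hc.integrableOn_Icc (a := -|a|) (b := |a|)).union (integrableOn_fC_Ioi hw)).mono_set ?_
  intro t ht
  by_cases h0 : 0 < t
  · exact Or.inr h0
  · refine Or.inl ⟨?_, ?_⟩
    · have : a < t := ht
      linarith [neg_abs_le a]
    · linarith [abs_nonneg a]

/-- Translating by `u` moves the half-line indicator: `𝟙_{(0,∞)} · h(· − u) = (𝟙_{(−u,∞)} h)(· − u)`. -/
theorem indicator_Ioi_comp_sub {E : Type*} [Zero E] (h : ℝ → E) (u : ℝ) :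
    (Ioi (0 : ℝ)).indicator (fun s => h (s - u)) = fun s => (Ioi (-u)).indicator h (s - u) := by
  funext s
  by_cases hs : (0 : ℝ) < s
  · have h2 : s - u ∈ Ioi (-u) := by rw [Set.mem_Ioi]; linarith
    rw [Set.indicator_of_mem (show s ∈ Ioi (0 : ℝ) from hs), Set.indicator_of_mem h2]
  · have h2 : s - u ∉ Ioi (-u) := by rw [Set.mem_Ioi]; linarith
    rw [Set.indicator_of_notMem (show s ∉ Ioi (0 : ℝ) from hs), Set.indicator_of_notMem h2]

/-- Half-line substitution `∫_{(0,∞)} h(s − u) ds = ∫_{(−u,∞)} h(t) dt`. -/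
theorem setIntegral_Ioi_comp_sub {E : Type*} [NormedAddCommGroup E] [NormedSpace ℝ E]
    (h : ℝ → E) (u : ℝ) :
    (∫ s in Ioi (0 : ℝ), h (s - u)) = ∫ t in Ioi (-u), h t := by
  rw [← integral_indicator measurableSet_Ioi, ← integral_indicator measurableSet_Ioi,
    indicator_Ioi_comp_sub]
  exact integral_sub_right_eq_self (fun t => (Ioi (-u)).indicator h t) u

/-- Integrability on `(0, ∞)` of the translate `s ↦ h (s − u)` from integrability of `h` on `(−u, ∞)`. -/
theorem integrableOn_Ioi_comp_sub {E : Type*} [NormedAddCommGroup E] {h : ℝ → E} {u : ℝ}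
    (hh : IntegrableOn h (Ioi (-u))) : IntegrableOn (fun s => h (s - u)) (Ioi 0) := by
  rw [← integrable_indicator_iff measurableSet_Ioi] at hh ⊢
  rw [indicator_Ioi_comp_sub]
  exact hh.comp_sub_right u

/-- **(B3, inner)** `∫₀^∞ fC(s−u) e^{−ws} ds = e^{−wu} (∫_{−u}^0 fC e^{−w·} + Lap fC(w))`. -/
theorem inner_laplace_shift {w : ℂ} (hw : 1 / 2 < w.re) (u : ℝ) :
    (∫ s in Ioi (0 : ℝ), fC (s - u) * cexp (-(w * s))) =
      cexp (-(w * u)) * ((∫ t in (-u)..0, fC t * cexp (-(w * t))) + lap fC w) := by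
  have h1 : (fun s : ℝ => fC (s - u) * cexp (-(w * s))) =
      fun s => (fun t : ℝ => cexp (-(w * u)) * (fC t * cexp (-(w * t)))) (s - u) := by
    funext s; simp only
    rw [show -(w * (s : ℂ)) = -(w * u) + -(w * ((s - u : ℝ) : ℂ)) by push_cast; ring,
      Complex.exp_add]; ring
  rw [h1, setIntegral_Ioi_comp_sub (fun t : ℝ => cexp (-(w * u)) * (fC t * cexp (-(w * t)))) u,
    integral_const_mul, ← intervalIntegral.integral_interval_add_Ioi
      (integrableOn_fC_Ioi' hw (-u)) (integrableOn_fC_Ioi hw)]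
  rfl

/-- **(B3, Fubini)** the kernel `(s, u) ↦ fC(s−u) c(u) e^{−ws}` is integrable on `(0,∞) × ℝ`
for `Re w > 1/2` and `c` continuous with compact support. -/
theorem integrable_laplaceKernel {c : ℝ → ℂ} (hc : Continuous c) (hcs : HasCompactSupport c)
    {w : ℂ} (hw : 1 / 2 < w.re) :
    Integrable (Function.uncurry fun (s u : ℝ) => fC (s - u) * c u * cexp (-(w * s)))
      ((volume.restrict (Ioi (0 : ℝ))).prod volume) := by
  obtain ⟨L, hL⟩ := hcs.isCompact.isBounded.subset_closedBall 0
  have hc0 : ∀ u, L < |u| → c u = 0 := fun u hu => image_eq_zero_of_notMem_tsupport fun h => by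
    have := hL h; rw [Metric.mem_closedBall, dist_zero_right, Real.norm_eq_abs] at this; linarith
  set σ : ℝ := w.re with hσ
  have hσ0 : 0 < σ := by linarith
  have hσw : 1 / 2 < (σ : ℂ).re := by simpa using hw
  have hmeas : AEStronglyMeasurable
      (Function.uncurry fun (s u : ℝ) => fC (s - u) * c u * cexp (-(w * s)))
      ((volume.restrict (Ioi (0 : ℝ))).prod volume) :=
    (((continuous_fC.comp (continuous_fst.sub continuous_snd)).mul (hc.comp continuous_snd)).mul
      (by fun_prop)).aestronglyMeasurable
  rw [integrable_prod_iff' hmeas]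
  -- the norm kernel and its constant
  set G : ℝ := ∫ t in Ioi (-|L|), ‖fC t * cexp (-((σ : ℂ) * t))‖ with hG
  have hGint : IntegrableOn (fun t : ℝ => ‖fC t * cexp (-((σ : ℂ) * t))‖) (Ioi (-|L|)) :=
    (integrableOn_fC_Ioi' hσw (-|L|)).norm
  have hnorm : ∀ s u : ℝ, ‖fC (s - u) * c u * cexp (-(w * s))‖ =
      ‖c u‖ * (Real.exp (-(σ * u)) * ‖fC (s - u) * cexp (-((σ : ℂ) * ((s - u : ℝ) : ℂ)))‖) := by
    intro s u
    rw [norm_mul, norm_mul, norm_mul, Complex.norm_exp, Complex.norm_exp]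
    have e1 : (-(w * (s : ℂ))).re = -(σ * s) := by simp [hσ, Complex.mul_re]
    have e2 : (-((σ : ℂ) * ((s - u : ℝ) : ℂ))).re = -(σ * (s - u)) := by
      simp [Complex.mul_re, Complex.ofReal_re, Complex.ofReal_im]
    rw [e1, e2, show -(σ * s) = -(σ * u) + -(σ * (s - u)) by ring, Real.exp_add]; ring
  constructor
  · refine Eventually.of_forall fun u => ?_
    have h1 : (fun s : ℝ => fC (s - u) * c u * cexp (-(w * s))) =
        fun s => (fun t : ℝ => c u * cexp (-(w * u)) * (fC t * cexp (-(w * t)))) (s - u) := by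
      funext s; simp only
      rw [show -(w * (s : ℂ)) = -(w * u) + -(w * ((s - u : ℝ) : ℂ)) by push_cast; ring,
        Complex.exp_add]; ring
    show IntegrableOn (fun s : ℝ => fC (s - u) * c u * cexp (-(w * s))) (Ioi 0) volume
    rw [h1]
    exact integrableOn_Ioi_comp_sub (((integrableOn_fC_Ioi' hw (-u))).const_mul _)
  · -- domination of the norm integral by `‖c u‖ · e^{σ|L|} · G`
    have hN_meas : AEStronglyMeasurable
        (fun u : ℝ => ∫ s : ℝ, ‖fC (s - u) * c u * cexp (-(w * s))‖ ∂(volume.restrict (Ioi 0)))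
        volume :=
      hmeas.prod_swap.norm.integral_prod_right'
    refine Integrable.mono' (g := fun u => ‖c u‖ * (Real.exp (σ * |L|) * G)) ?_ hN_meas ?_
    · exact ((continuous_norm.comp hc).mul continuous_const).integrable_of_hasCompactSupport
        (HasCompactSupport.intro hcs fun u hu => by simp [image_eq_zero_of_notMem_tsupport hu])
    · refine Eventually.of_forall fun u => ?_
      rw [Real.norm_of_nonneg (integral_nonneg fun s => norm_nonneg _)]
      by_cases hu : L < |u|
      · simp [hc0 u hu]
      have huL : |u| ≤ |L| := (not_lt.mp hu).trans (le_abs_self L)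
      simp only [Function.uncurry_apply_pair]
      simp_rw [hnorm]
      rw [integral_const_mul, integral_const_mul]
      refine mul_le_mul_of_nonneg_left ?_ (norm_nonneg _)
      rw [setIntegral_Ioi_comp_sub (fun t : ℝ => ‖fC t * cexp (-((σ : ℂ) * (t : ℂ)))‖) u]
      refine mul_le_mul ?_ ?_ (integral_nonneg fun t => norm_nonneg _) (Real.exp_pos _).le
      · rw [Real.exp_le_exp]; nlinarith [abs_le.mp huL, neg_abs_le u, le_abs_self u]
      · refine setIntegral_mono_set hGint (Eventually.of_forall fun t => norm_nonneg _)
          (Eventually.of_forall (Set.Ioi_subset_Ioi (by linarith [abs_le.mp huL]) ))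

/-- **(B) holds.** -/
theorem pieceB_holds : PieceB := by
  rintro Q φ hφ ⟨hcont, C, hC⟩
  have hc : Continuous (corr Q φ) := continuous_corr Q hφ
  have hcs : HasCompactSupport (corr Q φ) := hasCompactSupport_corr Q hφ
  refine ⟨differentiableOn_lap hcont C hC, Hfun (corr Q φ), differentiable_Hfun hc hcs,
    fun w hw => ?_⟩
  have hw' : 1 / 2 < w.re := by linarith
  have hF : transl Q φ = fun s => ∫ u, fC (s - u) * corr Q φ u := funext (transl_eq_conv Q hφ)
  have hint1 : Integrable fun u : ℝ =>
      corr Q φ u * cexp (-(w * u)) * ∫ t in (-u)..0, fC t * cexp (-(w * t)) :=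
    ((hc.mul (by fun_prop)).mul (continuous_innerInt w)).integrable_of_hasCompactSupport
      (HasCompactSupport.intro hcs fun u hu => by simp [image_eq_zero_of_notMem_tsupport hu])
  have hint2 : Integrable fun u : ℝ => corr Q φ u * cexp (-(w * u)) * lap fC w :=
    ((hc.mul (by fun_prop)).mul continuous_const).integrable_of_hasCompactSupport
      (HasCompactSupport.intro hcs fun u hu => by simp [image_eq_zero_of_notMem_tsupport hu])
  rw [show lap (transl Q φ) w = ∫ s in Ioi (0 : ℝ), (∫ u, fC (s - u) * corr Q φ u) * cexp (-(w * s))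
    by rw [lap, hF]]
  calc (∫ s in Ioi (0 : ℝ), (∫ u, fC (s - u) * corr Q φ u) * cexp (-(w * s)))
      = ∫ s in Ioi (0 : ℝ), ∫ u, fC (s - u) * corr Q φ u * cexp (-(w * s)) := by
        congr 1; funext s; rw [← integral_mul_const]
    _ = ∫ u, ∫ s in Ioi (0 : ℝ), fC (s - u) * corr Q φ u * cexp (-(w * s)) :=
        integral_integral_swap (integrable_laplaceKernel hc hcs hw')
    _ = ∫ u, (corr Q φ u * cexp (-(w * u)) * (∫ t in (-u)..0, fC t * cexp (-(w * t))) +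
          corr Q φ u * cexp (-(w * u)) * lap fC w) := by
        congr 1; funext u
        have h1 : (∫ s in Ioi (0 : ℝ), fC (s - u) * corr Q φ u * cexp (-(w * s))) =
            corr Q φ u * ∫ s in Ioi (0 : ℝ), fC (s - u) * cexp (-(w * s)) := by
          rw [← integral_const_mul]; congr 1; funext s; ring
        rw [h1, inner_laplace_shift hw' u]; ring
    _ = Hfun (corr Q φ) w + (∫ u, corr Q φ u * cexp (-(w * u))) * lap fC w := by
        rw [integral_add hint1 hint2, integral_mul_const]; rfl
    _ = bilap (corr Q φ) w * lap fC w + Hfun (corr Q φ) w := by rw [add_comm]; rfl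

/-! ## MAIN THEOREM of the scratch: the analytic core, kernel-checked

All six pieces are now theorems, so `core_of_pieces` specialises to an unconditional statement:
for every nonzero polynomial `Q` making the `Q(−i d/dx)`-twisted screw form nonnegative, all but
finitely many nontrivial zeta zeros lie on the critical line.  Combined with
`xii/ScrewIndexTransferKrein.indexTransferKrein_of_core` this leaves exactly ONE printed input
(Kreĭn 1959 / Stewart 1972 Thm 3.1, the Literature fact `Stewart1972_thm_3_1`) between
`IndexBounded` and `CofiniteCriticalLine`.  Nothing here asserts anything about RH. -/
/-- **Analytic core (unconditional).** For every nonzero polynomial `Q` with `KreinPos Q` (the `Q(−i d/dx)`-twisted screw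
form nonnegative on test functions), all but finitely many nontrivial zeta zeros lie on the critical line
(`core_of_pieces` with all six pieces proved).  `CofiniteCriticalLine` is not RH; nothing here asserts RH. -/
theorem core : ∀ Q : Polynomial ℂ, Q ≠ 0 → KreinPos Q → CofiniteCriticalLine :=
  core_of_pieces pieceA_holds pieceB_holds pieceC_holds pieceD_holds pieceE_holds pieceF_holds


/-! ## Discharge of lane (xii): `IndexTransferKrein`, and T2 «ETAIL ⟺ FOZ» modulo the named fact -/

/-- **KB2 discharged.** `IndexTransferKrein` (`Stewart1972_thm_3_1 → IndexBounded → CofiniteCriticalLine`)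
holds: the fact, applied to `f = −Ψ` at its exact negative index `k` (tree: `exists_exactIndex`,
`indexTransferKrein_of_core`), yields `Q ≠ 0` with `KreinPos Q`, and `core` concludes. -/
theorem indexTransferKrein : ScrewIndexTransferKrein.IndexTransferKrein :=
  ScrewIndexTransferKrein.indexTransferKrein_of_core fun h1 k hle hex => by
    obtain ⟨Q, hQ0, -, hpos⟩ :=
      h1 (fun u : ℝ => ((-zetaScrew u : ℝ) : ℂ)) ScrewIndexTransferKrein.negScrewC_symm k continuous_fC
        hle hex
    exact core Q hQ0 hpos

/-- **T2 «ETAIL ⟺ FOZ» modulo the single named printed fact** (Kreĭn 1959 / Stewart 1972 Thm 3.1):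
eventual positivity of the screw pivots `d_M` is equivalent to all but finitely many nontrivial zeta zeros
lying on the critical line.  (`→` uses the fact via `indexTransferKrein`; `←` is the tree's unconditional
`etail_of_foz`.)  Neither side is RH; nothing here bears on the truth of RH. -/
theorem etail_iff_foz (h1 : Stewart1972_thm_3_1) :
    (∃ M₀ : ℕ, ∀ M : ℕ, M₀ ≤ M → 0 < screwPivot M) ↔ CofiniteCriticalLine :=
  ScrewIndexTransferKrein.etail_iff_foz_of_indexTransferKrein indexTransferKrein h1

/-- The same with the bounded-negative-index formulation in the middle (tree: `etail_iff_boundedIndex`). -/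
theorem indexBounded_imp_foz (h1 : Stewart1972_thm_3_1)
    (hK : ∃ K : ℕ, ∀ n : ℕ,
      (Finset.univ.filter fun i => (screwMatrix_isHermitian n).eigenvalues i < 0).card ≤ K) :
    CofiniteCriticalLine :=
  indexTransferKrein h1 hK

end Summit.RiemannHypothesis.RiemannHypothesis.Theorems.Splittings.ScrewKreinCore

end
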